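import Literature.Computability.QuantumComplexity.IQPForrelation

/-!
# Crux `CubicForrelation.NearExactIsExact` (stmt-QuantumAdvantage-14043) — n = 12, configuration (β): the six sign patterns are AFFINE

Certificate seat `b2b-cforr-cert` (gen 25).  HONEST FRAMING: a finite combinatorial lemma (standard axioms) — STEP 3 of the (β) × (β)
kill at `Φ = 29/32` (HOME/b2b-cforr-cert-g25/PLAN-N12-928-BETA.md, "BREAKTHROUGH"); it claims NO value of `θ₁₂`.  NOT summit progress.

Pure Boolean bookkeeping, independent of forrelation: `P` is a set of bit vectors containing `0` and closed under `⊕`, `β` any Boolean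
function, `m₁, …, m₅, s` six anchors, and the TRANSVERSAL IDENTITY (`tbt_transversal` (B)) holds:
`β(m₁⊕v) ⊕ β(m₂⊕v⊕t₁) ⊕ β(m₃⊕v⊕t₂) ⊕ β(m₄⊕v⊕t₃) ⊕ β(m₅⊕v⊕t₄) ⊕ β(s⊕v⊕t₁⊕t₂⊕t₃⊕t₄) = 1` for all `v, tⱼ ∈ P`.
Then (`tba_affine`) every anchor `a ∈ {m₁, …, m₅, s}` has an affine sign pattern on its coset:
`β(a ⊕ p ⊕ q) = β(a ⊕ p) ⊕ β(a ⊕ q) ⊕ β(a)` for `p, q ∈ P`.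
Proof: specialising the identity (all `t = 0`; one `tⱼ = t`; `t₁ = t, t₂ = t'`) gives `D_t βⱼ = D_t β_s` (`j = 2..5`), the vanishing of
the second differences of `β_s`, hence of every `βⱼ`, and `β₁ = 1 ⊕ Σ βⱼ ⊕ β_s` is affine as well.

References: MacWilliams–Sloane (1977) Ch. 13 §3 (first-order Reed–Muller codewords on a flat).  Axioms: the standard three.
-/

set_option linter.dupNamespace false -- D-0017: single-problem summit ⇒ `QuantumAdvantage.QuantumAdvantage` by design

namespace Summit.QuantumAdvantage.QuantumAdvantage.Theorems.CubicForrelation.NearExactIsExact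

open Finset
open Literature.Computability.QuantumComplexity
open Literature.Computability.QuantumComplexity.BuzetChailloux (bxor zeroVec bxor_bxor_cancel_left bxor_zeroVec zeroVec_bxor bxor_comm
  bxor_self)

/-- Bool bookkeeping: two six-term parities sharing four terms. [folklore] -/
theorem tba_L2 : ∀ a b c d e f b' f' : Bool, (a ^^ b ^^ c ^^ d ^^ e ^^ f) = true → (a ^^ b' ^^ c ^^ d ^^ e ^^ f') = true →
    (b' ^^ f') = (b ^^ f) := by decide

/-- Bool bookkeeping: two six-term parities sharing four terms. [folklore] -/
theorem tba_L3 : ∀ a b c d e f c' f' : Bool, (a ^^ b ^^ c ^^ d ^^ e ^^ f) = true → (a ^^ b ^^ c' ^^ d ^^ e ^^ f') = true →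
    (c' ^^ f') = (c ^^ f) := by decide

/-- Bool bookkeeping: two six-term parities sharing four terms. [folklore] -/
theorem tba_L4 : ∀ a b c d e f d' f' : Bool, (a ^^ b ^^ c ^^ d ^^ e ^^ f) = true → (a ^^ b ^^ c ^^ d' ^^ e ^^ f') = true →
    (d' ^^ f') = (d ^^ f) := by decide

/-- Bool bookkeeping: two six-term parities sharing four terms. [folklore] -/
theorem tba_L5 : ∀ a b c d e f e' f' : Bool, (a ^^ b ^^ c ^^ d ^^ e ^^ f) = true → (a ^^ b ^^ c ^^ d ^^ e' ^^ f') = true →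
    (e' ^^ f') = (e ^^ f) := by decide

/-- Bool bookkeeping: the second difference of the last pattern vanishes. [folklore] -/
theorem tba_LA : ∀ a b c d e f b' f' c'' f'' g : Bool, (a ^^ b ^^ c ^^ d ^^ e ^^ f) = true → (b' ^^ f') = (b ^^ f) →
    (c'' ^^ f'') = (c ^^ f) → (a ^^ b' ^^ c'' ^^ d ^^ e ^^ g) = true → g = (f' ^^ f'' ^^ f) := by decide

/-- Bool bookkeeping: transport of affinity from the last pattern to a middle one. [folklore] -/
theorem tba_LM : ∀ x2pq xspq x2 xs x2p xsp x2q xsq : Bool, (x2pq ^^ xspq) = (x2 ^^ xs) → (x2p ^^ xsp) = (x2 ^^ xs) →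
    (x2q ^^ xsq) = (x2 ^^ xs) → xspq = (xsp ^^ xsq ^^ xs) → x2pq = (x2p ^^ x2q ^^ x2) := by decide

/-- Bool bookkeeping: transport of affinity to the first pattern. [folklore] -/
theorem tba_LX : ∀ rpq rp rq r0 x1pq x1p x1q x1 : Bool, (x1pq ^^ rpq) = true → (x1p ^^ rp) = true → (x1q ^^ rq) = true →
    (x1 ^^ r0) = true → rpq = (rp ^^ rq ^^ r0) → x1pq = (x1p ^^ x1q ^^ x1) := by decide

/-- Bool bookkeeping: re-association of a six-term parity. [folklore] -/
theorem tba_assoc6 (a b c d e f : Bool) : (a ^^ b ^^ c ^^ d ^^ e ^^ f) = (a ^^ (b ^^ c ^^ d ^^ e ^^ f)) := by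
  cases a <;> cases b <;> cases c <;> cases d <;> cases e <;> cases f <;> rfl

/-- Bool bookkeeping: the xor of two affine patterns is affine. [folklore] -/
theorem tba_Laff2 : ∀ fpq fp fq f0 gpq gp gq g0 : Bool, fpq = (fp ^^ fq ^^ f0) → gpq = (gp ^^ gq ^^ g0) →
    (fpq ^^ gpq) = ((fp ^^ gp) ^^ (fq ^^ gq) ^^ (f0 ^^ g0)) := by decide

/-- **Affine sign patterns on the six cosets** (module docstring). [this work] -/
theorem tba_affine (P : Finset (Fin (6 + 6) → Bool)) (hP0 : zeroVec ∈ P) (hPadd : ∀ a ∈ P, ∀ b ∈ P, bxor a b ∈ P)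
    (β : (Fin (6 + 6) → Bool) → Bool) (m₁ m₂ m₃ m₄ m₅ s : Fin (6 + 6) → Bool)
    (hstar : ∀ v ∈ P, ∀ t₁ ∈ P, ∀ t₂ ∈ P, ∀ t₃ ∈ P, ∀ t₄ ∈ P,
      (β (bxor m₁ v) ^^ β (bxor m₂ (bxor v t₁)) ^^ β (bxor m₃ (bxor v t₂)) ^^ β (bxor m₄ (bxor v t₃)) ^^ β (bxor m₅ (bxor v t₄)) ^^
        β (bxor s (bxor (bxor (bxor (bxor v t₁) t₂) t₃) t₄))) = true) :
    ∀ a ∈ ({m₁, m₂, m₃, m₄, m₅, s} : Finset (Fin (6 + 6) → Bool)), ∀ p ∈ P, ∀ q ∈ P,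
      β (bxor a (bxor p q)) = (β (bxor a p) ^^ β (bxor a q) ^^ β a) := by
  classical
  -- (1): all `t = 0`
  have E : ∀ v ∈ P, (β (bxor m₁ v) ^^ β (bxor m₂ v) ^^ β (bxor m₃ v) ^^ β (bxor m₄ v) ^^ β (bxor m₅ v) ^^ β (bxor s v)) = true := by
    intro v hv
    simpa only [bxor_zeroVec] using hstar v hv zeroVec hP0 zeroVec hP0 zeroVec hP0 zeroVec hP0
  -- first differences: `D_t βⱼ = D_t β_s`
  have D2 : ∀ v ∈ P, ∀ t ∈ P, (β (bxor m₂ (bxor v t)) ^^ β (bxor s (bxor v t))) = (β (bxor m₂ v) ^^ β (bxor s v)) := by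
    intro v hv t ht
    have h2 := hstar v hv t ht zeroVec hP0 zeroVec hP0 zeroVec hP0
    simp only [bxor_zeroVec] at h2
    exact tba_L2 _ _ _ _ _ _ _ _ (E v hv) h2
  have D3 : ∀ v ∈ P, ∀ t ∈ P, (β (bxor m₃ (bxor v t)) ^^ β (bxor s (bxor v t))) = (β (bxor m₃ v) ^^ β (bxor s v)) := by
    intro v hv t ht
    have h2 := hstar v hv zeroVec hP0 t ht zeroVec hP0 zeroVec hP0
    simp only [bxor_zeroVec] at h2
    exact tba_L3 _ _ _ _ _ _ _ _ (E v hv) h2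
  have D4 : ∀ v ∈ P, ∀ t ∈ P, (β (bxor m₄ (bxor v t)) ^^ β (bxor s (bxor v t))) = (β (bxor m₄ v) ^^ β (bxor s v)) := by
    intro v hv t ht
    have h2 := hstar v hv zeroVec hP0 zeroVec hP0 t ht zeroVec hP0
    simp only [bxor_zeroVec] at h2
    exact tba_L4 _ _ _ _ _ _ _ _ (E v hv) h2
  have D5 : ∀ v ∈ P, ∀ t ∈ P, (β (bxor m₅ (bxor v t)) ^^ β (bxor s (bxor v t))) = (β (bxor m₅ v) ^^ β (bxor s v)) := by
    intro v hv t ht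
    have h2 := hstar v hv zeroVec hP0 zeroVec hP0 zeroVec hP0 t ht
    simp only [bxor_zeroVec] at h2
    exact tba_L5 _ _ _ _ _ _ _ _ (E v hv) h2
  -- second differences of `β_s` vanish
  have AS : ∀ v ∈ P, ∀ t ∈ P, ∀ t' ∈ P,
      β (bxor s (bxor (bxor v t) t')) = (β (bxor s (bxor v t)) ^^ β (bxor s (bxor v t')) ^^ β (bxor s v)) := by
    intro v hv t ht t' ht'
    have h3 := hstar v hv t ht t' ht' zeroVec hP0 zeroVec hP0
    simp only [bxor_zeroVec] at h3
    exact tba_LA _ _ _ _ _ _ _ _ _ _ _ (E v hv) (D2 v hv t ht) (D3 v hv t' ht') h3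
  -- affinity of each pattern at base `0`
  have hs : ∀ p ∈ P, ∀ q ∈ P, β (bxor s (bxor p q)) = (β (bxor s p) ^^ β (bxor s q) ^^ β s) := by
    intro p hp q hq
    simpa only [zeroVec_bxor, bxor_zeroVec] using AS zeroVec hP0 p hp q hq
  have h2 : ∀ p ∈ P, ∀ q ∈ P, β (bxor m₂ (bxor p q)) = (β (bxor m₂ p) ^^ β (bxor m₂ q) ^^ β m₂) := by
    intro p hp q hq
    have a := D2 zeroVec hP0 (bxor p q) (hPadd _ hp _ hq); have b := D2 zeroVec hP0 p hp; have c := D2 zeroVec hP0 q hq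
    simp only [zeroVec_bxor, bxor_zeroVec] at a b c
    exact tba_LM _ _ _ _ _ _ _ _ a b c (hs p hp q hq)
  have h3 : ∀ p ∈ P, ∀ q ∈ P, β (bxor m₃ (bxor p q)) = (β (bxor m₃ p) ^^ β (bxor m₃ q) ^^ β m₃) := by
    intro p hp q hq
    have a := D3 zeroVec hP0 (bxor p q) (hPadd _ hp _ hq); have b := D3 zeroVec hP0 p hp; have c := D3 zeroVec hP0 q hq
    simp only [zeroVec_bxor, bxor_zeroVec] at a b c
    exact tba_LM _ _ _ _ _ _ _ _ a b c (hs p hp q hq)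
  have h4 : ∀ p ∈ P, ∀ q ∈ P, β (bxor m₄ (bxor p q)) = (β (bxor m₄ p) ^^ β (bxor m₄ q) ^^ β m₄) := by
    intro p hp q hq
    have a := D4 zeroVec hP0 (bxor p q) (hPadd _ hp _ hq); have b := D4 zeroVec hP0 p hp; have c := D4 zeroVec hP0 q hq
    simp only [zeroVec_bxor, bxor_zeroVec] at a b c
    exact tba_LM _ _ _ _ _ _ _ _ a b c (hs p hp q hq)
  have h5 : ∀ p ∈ P, ∀ q ∈ P, β (bxor m₅ (bxor p q)) = (β (bxor m₅ p) ^^ β (bxor m₅ q) ^^ β m₅) := by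
    intro p hp q hq
    have a := D5 zeroVec hP0 (bxor p q) (hPadd _ hp _ hq); have b := D5 zeroVec hP0 p hp; have c := D5 zeroVec hP0 q hq
    simp only [zeroVec_bxor, bxor_zeroVec] at a b c
    exact tba_LM _ _ _ _ _ _ _ _ a b c (hs p hp q hq)
  have h1 : ∀ p ∈ P, ∀ q ∈ P, β (bxor m₁ (bxor p q)) = (β (bxor m₁ p) ^^ β (bxor m₁ q) ^^ β m₁) := by
    intro p hp q hq
    have epq := E (bxor p q) (hPadd _ hp _ hq); have ep := E p hp; have eq' := E q hq; have e0 := E zeroVec hP0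
    simp only [bxor_zeroVec] at e0
    rw [tba_assoc6] at epq ep eq' e0
    refine tba_LX _ _ _ _ _ _ _ _ epq ep eq' e0 ?_
    have c23 := tba_Laff2 _ _ _ _ _ _ _ _ (h2 p hp q hq) (h3 p hp q hq)
    have c234 := tba_Laff2 _ _ _ _ _ _ _ _ c23 (h4 p hp q hq)
    have c2345 := tba_Laff2 _ _ _ _ _ _ _ _ c234 (h5 p hp q hq)
    exact tba_Laff2 _ _ _ _ _ _ _ _ c2345 (hs p hp q hq)
  intro a ha p hp q hq
  simp only [mem_insert, mem_singleton] at ha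
  rcases ha with rfl | rfl | rfl | rfl | rfl | rfl
  · exact h1 p hp q hq
  · exact h2 p hp q hq
  · exact h3 p hp q hq
  · exact h4 p hp q hq
  · exact h5 p hp q hq
  · exact hs p hp q hq

end Summit.QuantumAdvantage.QuantumAdvantage.Theorems.CubicForrelation.NearExactIsExact
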